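import Mathlib.RingTheory.MvPolynomial.Homogeneous
import Mathlib.LinearAlgebra.Matrix.Rank
import Mathlib.Data.Fin.Tuple.Basic
import HarnessLib

/-!
# Word tensors lifting a commutative form, their flattenings, and Nisan's width
# ("tensor-train rank of a lift")

Topic `Literature/Computability/AlgebraicComplexity`; definition item `defn-liftTTRank` (route
`ValiantsHypothesis/LiftNullstellensatz`, whose items `LiftAvoidanceQP`, `LiftWidthSuperlinear`,
`LiftWidthPerFour`, `PerLiftQPOfVP`, `DetReprLift`, `LiftWidthGeThree` inline (i)–(ii) below
verbatim).

## Mathematics (Nisan 1991)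

A homogeneous noncommutative polynomial of degree `N` in the letters `σ` over `k` is a **word
tensor** `Ψ : (Fin N → σ) → k` (the coefficient of the word `w₀ w₁ ⋯ w_{N-1}`).  Its image under
the abelianisation `k⟨σ⟩ → k[σ]` is the commutative form `Σ_w Ψ(w) · X_{w₀} ⋯ X_{w_{N-1}}`; we say
`Ψ` **lifts** `f ∈ k[σ]` when this image is `f` (so `f` is homogeneous of degree `N`,
`IsWordLift.isHomogeneous`).  For a cut `a + b = N`, Nisan's **partial-coefficient matrix**
`M_a(Ψ)` has rows indexed by words `u` of length `a`, columns by words `v` of length `b`, and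
entry `Ψ(uv)` (`wordFlattening`, the sequential flattening of the tensor `Ψ ∈ (k^σ)^{⊗N}` at the
cut `a | b`).  **Nisan's theorem** (N. Nisan, *Lower bounds for non-commutative computation*,
STOC 1991, Thm. 1): the minimal size of a homogeneous (layered) algebraic branching program
computing the noncommutative polynomial `Ψ` is `Σ_a rank M_a(Ψ)`, the `a`-th layer having exactly
`rank M_a(Ψ)` nodes in an optimal program; in particular its minimal WIDTH is
`max_a rank M_a(Ψ)` (`wordTTRank`, the tensor-train rank of `Ψ`).  Transported to commutative
forms: the minimal width of a homogeneous ABP with `N` layers of linear-form edges computing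
`f` is `min {wordTTRank Ψ : Ψ lifts f}` (`liftTTRank f N`), since such an ABP computes a
noncommutative `Ψ` lifting `f` and conversely.

## Contents (all `def`s are real; no named facts)

* `IsWordLift Ψ f` — (i) of the request, literally the inline text of the route:
  `(∑ w, Ψ w • ∏ t, X (w t)) = f`.
* `wordFlattening Ψ a b h` — (ii), literally the route's
  `Matrix.of fun u v => Ψ (fun t => Fin.append u v (Fin.cast h.symm t))`.
* `wordTTRank Ψ = max_{a ≤ N} rank (wordFlattening Ψ a (N - a) _)` (over a commutative ring, where
  Mathlib's `Matrix.rank` lives) and `liftTTRank f N = sInf {r | ∃ Ψ, IsWordLift Ψ f ∧ wordTTRank Ψ ≤ r}`.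
* API proved here: `IsWordLift.isHomogeneous` (a lifted form is homogeneous of degree `N`),
  `wordFlattening_apply`, `rank_wordFlattening_le_wordTTRank` (every cut is bounded by the
  TT-rank, in the form the route's items use: `∃ (a b) (h : a + b = N), r < rank (M_a)` follows
  from `r < wordTTRank`, `exists_cut_of_lt_wordTTRank`), `wordTTRank_le_iff`,
  `liftTTRank_le_of_isWordLift`, `liftTTRank_eq_zero_of_not_exists` (junk value).

## Junk values and what is NOT here

* `liftTTRank f N = 0` when `f` has no word lift of length `N` (e.g. `f` not homogeneous of
  degree `N`) — `sInf ∅ = 0` in `ℕ`; consumers quantify over lifts explicitly, as the route does.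
* `Matrix.rank` is Mathlib's (`finrank` of the range of `mulVecLin`), meaningful over a field
  (the route uses `k = ℂ`); `wordTTRank`/`liftTTRank` therefore assume `[CommRing k]`, while (i),
  (ii) are stated over a commutative semiring as requested.
* Not proved here (requested API, each a genuine lemma about ranks of flattenings of
  concatenated / summed word tensors): `liftTTRank (f * g) (N + M) ≤ max`, `liftTTRank (f + g) N ≤
  liftTTRank f N + liftTTRank g N`, monotonicity under linear substitutions, and Grenet's bound
  `liftTTRank (per_n) n ≤ Nat.choose n (n / 2)` (B. Grenet, 2011); nor Nisan's theorem itself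
  (no ABP syntax is introduced — the route works directly with word tensors).

## References

* N. Nisan, *Lower bounds for non-commutative computation*, Proc. 23rd STOC (1991), 410–418,
  §2 (partial-coefficient matrices `M_k`), Thm. 1 (ABP size `= Σ_k rank M_k(f)`, layer `k` has
  `rank M_k(f)` nodes). [Nisan1991]
-/

noncomputable section

open scoped BigOperators

namespace Literature.Computability.AlgebraicComplexity

/-! ### Word tensors lifting a commutative form -/

section Semiring

variable {k : Type*} [CommSemiring k] {σ : Type*} {N : ℕ}

/-- **`Ψ` is a word lift of `f`**: the word tensor `Ψ : (Fin N → σ) → k` (a homogeneous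
noncommutative polynomial of degree `N` in the letters `σ`, `Ψ w` = coefficient of the word `w`)
has commutative image `Σ_w Ψ(w) · X_{w 0} ⋯ X_{w (N-1)}` equal to `f`.  Literally the hypothesis
inlined by the items of route `LiftNullstellensatz`. (Nisan 1991, §2: noncommutative polynomials
as functions on words; the abelianisation map is folklore.) [cite: Nisan1991, §2] -/
def IsWordLift [Fintype σ] (Ψ : (Fin N → σ) → k) (f : MvPolynomial σ k) : Prop :=
  (∑ w : Fin N → σ, Ψ w • ∏ t, (MvPolynomial.X (w t) : MvPolynomial σ k)) = f

/-- Unfolding lemma for `IsWordLift`. [folklore] -/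
theorem isWordLift_iff [Fintype σ] {Ψ : (Fin N → σ) → k} {f : MvPolynomial σ k} :
    IsWordLift Ψ f ↔ (∑ w : Fin N → σ, Ψ w • ∏ t, (MvPolynomial.X (w t) : MvPolynomial σ k)) = f :=
  Iff.rfl

/-- The commutative image of a word of length `N` is homogeneous of degree `N`. [folklore] -/
theorem isHomogeneous_prod_X (w : Fin N → σ) :
    (∏ t, (MvPolynomial.X (w t) : MvPolynomial σ k)).IsHomogeneous N := by
  have h := MvPolynomial.IsHomogeneous.prod (Finset.univ : Finset (Fin N))
    (fun t => (MvPolynomial.X (w t) : MvPolynomial σ k)) (fun _ => 1)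
    (fun t _ => MvPolynomial.isHomogeneous_X k (w t))
  simpa using h

/-- **A lifted form is homogeneous of degree `N`** (the length of the words). [folklore] -/
theorem IsWordLift.isHomogeneous [Fintype σ] {Ψ : (Fin N → σ) → k} {f : MvPolynomial σ k}
    (h : IsWordLift Ψ f) : f.IsHomogeneous N := by
  rw [← h]
  refine MvPolynomial.IsHomogeneous.sum Finset.univ _ N fun w _ => ?_
  rw [MvPolynomial.smul_eq_C_mul]
  simpa using (MvPolynomial.isHomogeneous_C σ (Ψ w)).mul (isHomogeneous_prod_X (k := k) w)

end Semiring

/-! ### Nisan's partial-coefficient matrices (sequential flattenings) -/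

section Flattening

variable {k : Type*} {σ : Type*} {N : ℕ}

/-- **Nisan's partial-coefficient matrix `M_a(Ψ)` at the cut `a | b`, `a + b = N`** (the sequential
flattening of the word tensor): rows are words `u` of length `a`, columns words `v` of length `b`,
and the entry is the coefficient `Ψ(uv)` of the concatenated word (`Fin.append u v`, reindexed
along `Fin N = Fin (a + b)` by `Fin.cast`).  Literally the matrix inlined by the items of route
`LiftNullstellensatz`. (Nisan 1991, §2, "`M_k(f)`".) [cite: Nisan1991, §2] -/
def wordFlattening (Ψ : (Fin N → σ) → k) (a b : ℕ) (h : a + b = N) :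
    Matrix (Fin a → σ) (Fin b → σ) k :=
  Matrix.of fun u v => Ψ (fun t => Fin.append u v (Fin.cast h.symm t))

/-- Entries of the flattening, unfolded. [cite: Nisan1991, §2] -/
@[simp] theorem wordFlattening_apply (Ψ : (Fin N → σ) → k) (a b : ℕ) (h : a + b = N)
    (u : Fin a → σ) (v : Fin b → σ) :
    wordFlattening Ψ a b h u v = Ψ (fun t => Fin.append u v (Fin.cast h.symm t)) := rfl

end Flattening

/-! ### Tensor-train rank of a word tensor and the lift width of a form -/

section Ring

variable {k : Type*} [CommRing k] {σ : Type*} [Fintype σ] {N : ℕ}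

/-- The cut `i | N - i` is a cut of `N` for `i ≤ N` (index bookkeeping for `wordTTRank`). [folklore] -/
theorem cut_add_sub (i : Fin (N + 1)) : (i : ℕ) + (N - i) = N :=
  Nat.add_sub_cancel' (Nat.lt_succ_iff.mp i.2)

/-- **The tensor-train rank of the word tensor `Ψ`**: the maximum over the cuts `a + b = N`,
`0 ≤ a ≤ N`, of the rank of the flattening `M_a(Ψ)` (Mathlib `Matrix.rank`).  By Nisan's theorem
(1991, Thm. 1: in a minimal homogeneous algebraic branching program for the noncommutative
polynomial `Ψ` the `a`-th layer has exactly `rank M_a(Ψ)` nodes) this is the minimal WIDTH of a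
homogeneous ABP computing `Ψ`. [cite: Nisan1991, Thm. 1] -/
def wordTTRank (Ψ : (Fin N → σ) → k) : ℕ :=
  Finset.univ.sup fun i : Fin (N + 1) => (wordFlattening Ψ i (N - i) (cut_add_sub i)).rank

/-- Every cut rank is bounded by the tensor-train rank. [cite: Nisan1991, Thm. 1] -/
theorem rank_wordFlattening_le_wordTTRank (Ψ : (Fin N → σ) → k) (a b : ℕ) (h : a + b = N) :
    (wordFlattening Ψ a b h).rank ≤ wordTTRank Ψ := by
  have ha : a < N + 1 := by omega
  obtain rfl : b = N - a := by omega
  exact Finset.le_sup (f := fun i : Fin (N + 1) => (wordFlattening Ψ i (N - i) (cut_add_sub i)).rank)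
    (Finset.mem_univ (⟨a, ha⟩ : Fin (N + 1)))

/-- `wordTTRank Ψ ≤ r` iff every cut has rank `≤ r`. [cite: Nisan1991, Thm. 1] -/
theorem wordTTRank_le_iff {Ψ : (Fin N → σ) → k} {r : ℕ} :
    wordTTRank Ψ ≤ r ↔ ∀ (a b : ℕ) (h : a + b = N), (wordFlattening Ψ a b h).rank ≤ r := by
  constructor
  · intro hr a b h
    exact (rank_wordFlattening_le_wordTTRank Ψ a b h).trans hr
  · intro H
    refine Finset.sup_le fun i _ => ?_
    exact H i (N - i) (cut_add_sub i)

/-- If `r < wordTTRank Ψ` then some cut has rank `> r` — the form in which the items of route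
`LiftNullstellensatz` phrase "large width". [cite: Nisan1991, Thm. 1] -/
theorem exists_cut_of_lt_wordTTRank {Ψ : (Fin N → σ) → k} {r : ℕ} (hr : r < wordTTRank Ψ) :
    ∃ (a b : ℕ) (h : a + b = N), r < (wordFlattening Ψ a b h).rank := by
  by_contra H
  push Not at H
  exact (not_le.mpr hr) (wordTTRank_le_iff.mpr H)

/-- **The lift width (tensor-train rank of a lift) of the form `f` in degree `N`**:
`min {wordTTRank Ψ : Ψ a word lift of f}` — the minimal width of a homogeneous algebraic
branching program with `N` layers of linear-form edges computing `f` (Nisan's width theorem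
applied to the noncommutative preimages of `f`; see the module docstring).  **Junk value** `0`
when `f` has no word lift of length `N` (`sInf ∅ = 0`). [cite: Nisan1991, Thm. 1] -/
def liftTTRank (f : MvPolynomial σ k) (N : ℕ) : ℕ :=
  sInf {r | ∃ Ψ : (Fin N → σ) → k, IsWordLift Ψ f ∧ wordTTRank Ψ ≤ r}

/-- A lift bounds the lift width: `liftTTRank f N ≤ wordTTRank Ψ` for every word lift `Ψ` of
`f`. [cite: Nisan1991, Thm. 1] -/
theorem liftTTRank_le_of_isWordLift {f : MvPolynomial σ k} {Ψ : (Fin N → σ) → k}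
    (h : IsWordLift Ψ f) : liftTTRank f N ≤ wordTTRank Ψ :=
  Nat.sInf_le ⟨Ψ, h, le_rfl⟩

/-- If the lift width is attained below `r` then some lift has all cut ranks `≤ r`:
`liftTTRank f N ≤ r` and the existence of a lift give a lift `Ψ` with `wordTTRank Ψ ≤ r`. [cite: Nisan1991, Thm. 1] -/
theorem exists_isWordLift_of_liftTTRank_le {f : MvPolynomial σ k} {r : ℕ}
    (hex : ∃ Ψ : (Fin N → σ) → k, IsWordLift Ψ f) (hr : liftTTRank f N ≤ r) :
    ∃ Ψ : (Fin N → σ) → k, IsWordLift Ψ f ∧ wordTTRank Ψ ≤ r := by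
  obtain ⟨Ψ₀, h₀⟩ := hex
  have hne : {r | ∃ Ψ : (Fin N → σ) → k, IsWordLift Ψ f ∧ wordTTRank Ψ ≤ r}.Nonempty :=
    ⟨wordTTRank Ψ₀, Ψ₀, h₀, le_rfl⟩
  obtain ⟨Ψ, hΨ, hle⟩ := Nat.sInf_mem hne
  exact ⟨Ψ, hΨ, hle.trans hr⟩

/-- The junk value: without a word lift of length `N`, `liftTTRank f N = 0`. [folklore] -/
theorem liftTTRank_eq_zero_of_not_exists {f : MvPolynomial σ k}
    (h : ¬ ∃ Ψ : (Fin N → σ) → k, IsWordLift Ψ f) : liftTTRank f N = 0 := by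
  have hempty : {r | ∃ Ψ : (Fin N → σ) → k, IsWordLift Ψ f ∧ wordTTRank Ψ ≤ r} = ∅ := by
    ext r
    simp only [Set.mem_setOf_eq, Set.mem_empty_iff_false, iff_false, not_exists, not_and]
    exact fun Ψ hΨ _ => h ⟨Ψ, hΨ⟩
  rw [liftTTRank, hempty, Nat.sInf_empty]

end Ring

end Literature.Computability.AlgebraicComplexity

end
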